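import Summits.ResolutionOfSingularities.ResolutionOfSingularities.Theorems.HilbertSamuelEliminationSigmaMaxModificationsCorridor3WLadderSegmentsNearLocusIsolation
import Summits.ResolutionOfSingularities.ResolutionOfSingularities.Theorems.HilbertSamuelEliminationSigmaMaxModificationsCorridor3WLadderRecognitionNearLocusLocalize
import HarnessLib

/-!
# [OURS · L1 W4.2] RECOGNITION ASSEMBLY, brick M3-loc: ISOLATION IN THE NEAR LOCUS TRANSFERS ALONG THE COMPARISON EMBEDDING `ι_q`
# of a flat preimmersive base change (in particular along the localisation at `x_b`), and the `hniso` / `hiso` inputs of the unit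
# theorems READ ON THE LOCALISED TOWER `Seg.locTower b` (crux chain w42, line `w_ladder`; RULING v3.14-19 (FK); hand res-D-pv-038)

OURS (cell `res-hironaka`, slot W4.2, crux `stmt-ResolutionOfSingularities-18506` / conjunct `-19249`; `--supports … --as helper`, counted 0).
NOT a statement of the manuscript under review [claim: Hironaka2017, status: under-review] nor of [CossartJannsenSaito2020]; AI plumbing, weaker
than expert review; fact-free, no definition. This is the «isolation transfers along ι» brick of res-L1-w42-stub-1's ASSEMBLY-SPEC (Step B).

* `BlowupTowerNear.exists_isOpen_inter_nearLocus_baseChange_eq_singleton_iff` — for a base change `T ×_{X_0} S₀` along a flat preimmersion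
  `ι₀` and `s ∈ N^S_q(s₀)`: `s` is isolated in `N^S_q(s₀)` IFF `ι_q s` is isolated in `N_q(ι₀ s₀)` (`ι_q` is a topological embedding,
  `N^S_q = ι_q⁻¹ N_q`, `ι_q(N^S_q) = N_q`: res-L1-w42-stub-2's …Localize / res-type-053's `BlowupTowerLocalize`); closed/non-isolated witnesses
  transfer in both directions (`exists_closed_not_isolated_nearLocus_baseChange_iff`).
* On the chain (ns `…Moving.Seg`), at a base `b` isolated in its stratum: `not_isolated_nearLocus_loc_of_not_iso` / `exists_closed_not_isolated_nearLocus_loc_of_not_iso`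
  (¬`Iso` at stage `b + n` ⇒ the point of `(locTower b).X n` over `x_{b+n}` is a CLOSED near point NOT isolated in the localised near locus —
  the `hniso` input of `inducesIsoOn_of_unit` / `dichPlus_of_unit` on the localised towers) and `exists_isOpen_inter_nearLocus_loc_eq_singleton_of_iso`
  (`Iso` ⇒ isolated — the `hiso` input of `not_surjective_of_unit`), from the upTower forms of `…SegmentsNearLocusIsolation` (p532150).

[cite: CossartJannsenSaito2020, Def. 6.38 (iv)/(v), Def. 13.3, p. 107]
-/

noncomputable section

set_option linter.dupNamespace false -- namespace `…Corridor3.*` re-enters `…Corridor3` (module convention of these files)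

open CategoryTheory AlgebraicGeometry TopologicalSpace Topology IsLocalRing
open Literature.AlgebraicGeometry.Resolution Literature.RingTheory.HilbertSamuel
open Literature.AlgebraicGeometry.CossartJannsenSaito2020
open Scheme.IdealSheafData

universe u

namespace Summit.ResolutionOfSingularities.ResolutionOfSingularities.Theorems.SigmaMaxModificationsCorridor3

/-! ## §1. Isolation in the near locus along a flat preimmersive base change -/

namespace Helpers.BlowupTowerNear

section BaseChange

variable (T : BlowupTower.{u}) {S₀ : Scheme.{u}} (ι₀ : S₀ ⟶ T.X 0) [Flat ι₀] [IsPreimmersion ι₀] [IsLocallyNoetherian S₀]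
  (N : ℕ) (s₀ : S₀) (q : ℕ)

/-- **Isolation in the near locus transfers along `ι_q`**: for `s ∈ N^S_q(s₀)`, some open set of `S_q` meets `N^S_q(s₀)` in `{s}` iff some open
set of `X_q` meets `N_q(ι₀ s₀)` in `{ι_q s}` (`ι_q` is an embedding with `N^S_q = ι_q⁻¹ N_q` and `ι_q(N^S_q) = N_q`).
[cite: CossartJannsenSaito2020, p. 107] [cite: StacksProject, Tag 01J7] -/
theorem exists_isOpen_inter_nearLocus_baseChange_eq_singleton_iff {s : T.bcX ι₀ q} (hs : s ∈ (T.baseChange ι₀).nearLocus N s₀ q) :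
    (∃ O : Set (T.bcX ι₀ q), IsOpen O ∧ O ∩ (T.baseChange ι₀).nearLocus N s₀ q = {s}) ↔
      ∃ O : Set (T.X q), IsOpen O ∧ O ∩ T.nearLocus N (ι₀.base s₀) q = {(T.bcι ι₀ q).base s} := by
  haveI := T.isPreimmersion_bcι ι₀ q
  have hemb : IsEmbedding (T.bcι ι₀ q).base := (T.bcι ι₀ q).isEmbedding
  have hinj : Function.Injective (T.bcι ι₀ q).base := T.bcι_injective ι₀ q
  have hpre : (T.baseChange ι₀).nearLocus N s₀ q = (T.bcι ι₀ q).base ⁻¹' T.nearLocus N (ι₀.base s₀) q :=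
    T.nearLocus_baseChange ι₀ N s₀ q
  have himg : (T.bcι ι₀ q).base '' (T.baseChange ι₀).nearLocus N s₀ q = T.nearLocus N (ι₀.base s₀) q :=
    image_nearLocus_baseChange T ι₀ N s₀ q
  constructor
  · rintro ⟨O, hO, hOeq⟩
    obtain ⟨O', hO', hpreO⟩ := hemb.isInducing.isOpen_iff.mp hO
    refine ⟨O', hO', Set.Subset.antisymm ?_ ?_⟩
    · rintro z ⟨hzO, hzN⟩
      rw [← himg] at hzN
      obtain ⟨t, ht, rfl⟩ := hzN
      have htO : t ∈ O := by rw [← hpreO]; exact hzO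
      have : t ∈ O ∩ (T.baseChange ι₀).nearLocus N s₀ q := ⟨htO, ht⟩
      rw [hOeq] at this
      rw [Set.mem_singleton_iff.mp this]; rfl
    · intro z hz
      obtain rfl : z = (T.bcι ι₀ q).base s := hz
      have hsO : s ∈ O := by
        have : s ∈ O ∩ (T.baseChange ι₀).nearLocus N s₀ q := by rw [hOeq]; exact Set.mem_singleton s
        exact this.1
      refine ⟨?_, ?_⟩
      · rw [← hpreO] at hsO; exact hsO
      · rw [hpre] at hs; exact hs
  · rintro ⟨O', hO', hOeq⟩
    refine ⟨(T.bcι ι₀ q).base ⁻¹' O', hO'.preimage (T.bcι ι₀ q).continuous, Set.Subset.antisymm ?_ ?_⟩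
    · rintro t ⟨htO, htN⟩
      have : (T.bcι ι₀ q).base t ∈ O' ∩ T.nearLocus N (ι₀.base s₀) q := ⟨htO, by rw [hpre] at htN; exact htN⟩
      rw [hOeq] at this
      exact Set.mem_singleton_iff.mpr (hinj (Set.mem_singleton_iff.mp this))
    · intro t ht
      obtain rfl : t = s := ht
      refine ⟨?_, hs⟩
      have : (T.bcι ι₀ q).base t ∈ O' ∩ T.nearLocus N (ι₀.base s₀) q := by rw [hOeq]; exact Set.mem_singleton _
      exact this.1

/-- **A closed non-isolated point of `N_q(ι₀ s₀)` comes from a closed non-isolated point of `N^S_q(s₀)` and conversely** (for `ι₀ s₀` closed;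
closedness of points transfers both ways along `ι_q` over `s₀`). This is the `hniso` currency of the unit theorems. [cite: CossartJannsenSaito2020, p. 107] -/
theorem exists_closed_not_isolated_nearLocus_baseChange_iff (hx : IsClosed ({ι₀.base s₀} : Set (T.X 0))) :
    (∃ s ∈ (T.baseChange ι₀).nearLocus N s₀ q, IsClosed ({s} : Set (T.bcX ι₀ q)) ∧
        ¬ ∃ O : Set (T.bcX ι₀ q), IsOpen O ∧ O ∩ (T.baseChange ι₀).nearLocus N s₀ q = {s}) ↔
      ∃ z ∈ T.nearLocus N (ι₀.base s₀) q, IsClosed ({z} : Set (T.X q)) ∧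
        ¬ ∃ O : Set (T.X q), IsOpen O ∧ O ∩ T.nearLocus N (ι₀.base s₀) q = {z} := by
  constructor
  · rintro ⟨s, hs, hscl, hniso⟩
    exact ⟨_, (bijOn_nearLocus_baseChange T ι₀ N s₀ q).mapsTo hs, isClosed_singleton_bcι_of_phi_eq T ι₀ s₀ q hx hs.1 hscl,
      fun h => hniso ((exists_isOpen_inter_nearLocus_baseChange_eq_singleton_iff T ι₀ N s₀ q hs).mpr h)⟩
  · rintro ⟨z, hz, hzcl, hniso⟩
    obtain ⟨s, hs, rfl⟩ := (bijOn_nearLocus_baseChange T ι₀ N s₀ q).surjOn hz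
    exact ⟨s, hs, T.isClosed_singleton_of_bcι ι₀ q s hzcl,
      fun h => hniso ((exists_isOpen_inter_nearLocus_baseChange_eq_singleton_iff T ι₀ N s₀ q hs).mp h)⟩

/-- **An isolated closed point of `N_q(ι₀ s₀)` lifts to an isolated closed point of `N^S_q(s₀)`** (the `hiso`/`hzcl` inputs of
`not_surjective_of_unit`). [cite: CossartJannsenSaito2020, Def. 6.38 (v), p. 107] -/
theorem exists_closed_isolated_nearLocus_baseChange_of {z : T.X q} (hz : z ∈ T.nearLocus N (ι₀.base s₀) q)
    (hzcl : IsClosed ({z} : Set (T.X q))) (hiso : ∃ O : Set (T.X q), IsOpen O ∧ O ∩ T.nearLocus N (ι₀.base s₀) q = {z}) :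
    ∃ s ∈ (T.baseChange ι₀).nearLocus N s₀ q, (T.bcι ι₀ q).base s = z ∧ IsClosed ({s} : Set (T.bcX ι₀ q)) ∧
      ∃ O : Set (T.bcX ι₀ q), IsOpen O ∧ O ∩ (T.baseChange ι₀).nearLocus N s₀ q = {s} := by
  obtain ⟨s, hs, rfl⟩ := (bijOn_nearLocus_baseChange T ι₀ N s₀ q).surjOn hz
  exact ⟨s, hs, rfl, T.isClosed_singleton_of_bcι ι₀ q s hzcl,
    (exists_isOpen_inter_nearLocus_baseChange_eq_singleton_iff T ι₀ N s₀ q hs).mpr hiso⟩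

end BaseChange

section Localize

variable (T : BlowupTower.{u}) (N : ℕ) (x : T.X 0) (q : ℕ)

/-- **`hniso` transfers between `N_q(x)` and the near locus of the LOCALISED tower `T.localize x`** (closed point `𝔪_x`; `x` closed).
[cite: CossartJannsenSaito2020, Def. 6.38 (iv), p. 107] -/
theorem exists_closed_not_isolated_nearLocus_localize_iff (hx : IsClosed ({x} : Set (T.X 0))) :
    haveI : IsLocallyNoetherian (T.X 0) := T.ln 0
    haveI := flat_fromSpecStalk (T.X 0) x
    (∃ s ∈ (T.localize x).nearLocus N (closedPoint ((T.X 0).presheaf.stalk x)) q, IsClosed ({s} : Set ((T.localize x).X q)) ∧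
        ¬ ∃ O : Set ((T.localize x).X q), IsOpen O ∧ O ∩ (T.localize x).nearLocus N (closedPoint ((T.X 0).presheaf.stalk x)) q = {s}) ↔
      ∃ z ∈ T.nearLocus N x q, IsClosed ({z} : Set (T.X q)) ∧ ¬ ∃ O : Set (T.X q), IsOpen O ∧ O ∩ T.nearLocus N x q = {z} := by
  haveI : IsLocallyNoetherian (T.X 0) := T.ln 0
  haveI := flat_fromSpecStalk (T.X 0) x
  have hx' : IsClosed ({((T.X 0).fromSpecStalk x).base (closedPoint ((T.X 0).presheaf.stalk x))} : Set (T.X 0)) := by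
    rw [Scheme.fromSpecStalk_closedPoint]; exact hx
  have h := exists_closed_not_isolated_nearLocus_baseChange_iff T ((T.X 0).fromSpecStalk x) N (closedPoint ((T.X 0).presheaf.stalk x)) q hx'
  rwa [Scheme.fromSpecStalk_closedPoint] at h

/-- **An isolated closed point of `N_q(x)` lifts to an isolated closed point of the localised near locus, over it.**
[cite: CossartJannsenSaito2020, Def. 6.38 (v), p. 107] -/
theorem exists_closed_isolated_nearLocus_localize_of {z : T.X q} (hz : z ∈ T.nearLocus N x q)
    (hzcl : IsClosed ({z} : Set (T.X q))) (hiso : ∃ O : Set (T.X q), IsOpen O ∧ O ∩ T.nearLocus N x q = {z}) :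
    haveI : IsLocallyNoetherian (T.X 0) := T.ln 0
    haveI := flat_fromSpecStalk (T.X 0) x
    ∃ s ∈ (T.localize x).nearLocus N (closedPoint ((T.X 0).presheaf.stalk x)) q,
      (T.bcι ((T.X 0).fromSpecStalk x) q).base s = z ∧ IsClosed ({s} : Set ((T.localize x).X q)) ∧
      ∃ O : Set ((T.localize x).X q), IsOpen O ∧ O ∩ (T.localize x).nearLocus N (closedPoint ((T.X 0).presheaf.stalk x)) q = {s} := by
  haveI : IsLocallyNoetherian (T.X 0) := T.ln 0
  haveI := flat_fromSpecStalk (T.X 0) x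
  have hz' : z ∈ T.nearLocus N (((T.X 0).fromSpecStalk x).base (closedPoint ((T.X 0).presheaf.stalk x))) q := by
    rw [Scheme.fromSpecStalk_closedPoint]; exact hz
  have hiso' : ∃ O : Set (T.X q), IsOpen O ∧
      O ∩ T.nearLocus N (((T.X 0).fromSpecStalk x).base (closedPoint ((T.X 0).presheaf.stalk x))) q = {z} := by
    rw [Scheme.fromSpecStalk_closedPoint]; exact hiso
  exact exists_closed_isolated_nearLocus_baseChange_of T ((T.X 0).fromSpecStalk x) N (closedPoint ((T.X 0).presheaf.stalk x)) q hz' hzcl hiso'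

end Localize

end Helpers.BlowupTowerNear

/-! ## §2. On the chain: the localised marked points -/

namespace Moving.Seg

open Summit.ResolutionOfSingularities.ResolutionOfSingularities.Theorems.CampaignW42
open Summit.ResolutionOfSingularities.ResolutionOfSingularities.Theorems.SigmaMaxModificationsCorridor3.Helpers

variable {R : ∀ S : Scheme.{0}, CentreSeq S → Prop} {N : ℕ} {ν : ℕ → ℕ} {k : Type} [Field k]
  {c : ℕ → MarkedStage.{0}} (hc : ∀ n, CanonicalNearStep R N ν (c n) (c (n + 1))) (hRa : OracleAdmissible R)
  (hν : ν ≠ iterPSum N Phi) (h0 : Helpers.CycleInv k N ν (c 0))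
  {p : ℕ} {X : Scheme.{0}} [IsLocallyNoetherian X] {x : X} (hX : IsMaximalOrigin p N ν X x)
  (hreach : Reaches R N ν (MarkedStage.init X x) (c 0))

include hX hreach in
/-- **At a NON-`Iso` stage `b + n`, the localised near locus `N^loc_n` (over the closed point `𝔪_{x_b}` of `Spec 𝒪_{X_b,x_b}`) contains a CLOSED
point that is NOT isolated in it** — the point over the marked point `x_{b+n}` (base `b` isolated in its stratum). This is the `hniso` input of
res-L1-w42-stub-2's `inducesIsoOn_of_unit` / `dichPlus_of_unit` read on `locTower b` (and, through `compress`, on the unit towers).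
[cite: CossartJannsenSaito2020, Def. 6.38 (iv), p. 107] -/
theorem exists_closed_not_isolated_nearLocus_loc_of_not_iso (b : ℕ)
    (hU : ∃ U : Set (c b).W, IsOpen U ∧ (c b).pt ∈ U ∧ U ∩ Scheme.hsStratum (c b).W N ν ⊆ {(c b).pt}) (n : ℕ)
    (hniso : ¬ Iso N (c (b + n))) :
    ∃ s ∈ (locTower hc hRa hν h0 b).nearLocus N (basePt hc hRa hν h0 b) n, IsClosed ({s} : Set ((locTower hc hRa hν h0 b).X n)) ∧
      ¬ ∃ O : Set ((locTower hc hRa hν h0 b).X n), IsOpen O ∧ O ∩ (locTower hc hRa hν h0 b).nearLocus N (basePt hc hRa hν h0 b) n = {s} :=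
  (BlowupTowerNear.exists_closed_not_isolated_nearLocus_localize_iff (upTower hc hRa hν h0 b) N (c b).pt n
      (Reaches.isClosed_pt hX.isClosed (reaches_chain hreach hc b))).mpr
    (exists_closed_not_isolated_nearLocus_of_not_iso hc hRa hν h0 hX hreach b hU n hniso)

include hX hreach in
/-- The same keyed by `Iso N (c b)` at the base. [cite: CossartJannsenSaito2020, Def. 13.3] -/
theorem exists_closed_not_isolated_nearLocus_loc_of_not_iso' (b : ℕ) (hb : Iso N (c b)) (n : ℕ) (hniso : ¬ Iso N (c (b + n))) :
    ∃ s ∈ (locTower hc hRa hν h0 b).nearLocus N (basePt hc hRa hν h0 b) n, IsClosed ({s} : Set ((locTower hc hRa hν h0 b).X n)) ∧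
      ¬ ∃ O : Set ((locTower hc hRa hν h0 b).X n), IsOpen O ∧ O ∩ (locTower hc hRa hν h0 b).nearLocus N (basePt hc hRa hν h0 b) n = {s} :=
  exists_closed_not_isolated_nearLocus_loc_of_not_iso hc hRa hν h0 hX hreach b (stratumIsolated_at hc hRa hν hX hreach b hb) n hniso

include hX hreach in
/-- **At an `Iso` stage `b + n`, the point of `(locTower b).X n` over `x_{b+n}` is a CLOSED point ISOLATED in the localised near locus** (it exists
and is unique: `ι_n` is a bijection on near loci) — the `hzcl`/`hiso` inputs of `not_surjective_of_unit` read on `locTower b`.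
[cite: CossartJannsenSaito2020, Def. 6.38 (v), p. 107] -/
theorem exists_closed_isolated_nearLocus_loc_of_iso (b n : ℕ) (hiso : Iso N (c (b + n))) :
    ∃ s ∈ (locTower hc hRa hν h0 b).nearLocus N (basePt hc hRa hν h0 b) n, (locι hc hRa hν h0 b n).base s = (c (b + n)).pt ∧
      IsClosed ({s} : Set ((locTower hc hRa hν h0 b).X n)) ∧
      ∃ O : Set ((locTower hc hRa hν h0 b).X n), IsOpen O ∧ O ∩ (locTower hc hRa hν h0 b).nearLocus N (basePt hc hRa hν h0 b) n = {s} :=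
  BlowupTowerNear.exists_closed_isolated_nearLocus_localize_of (upTower hc hRa hν h0 b) N (c b).pt n
    (pt_mem_nearLocus hc hRa hν h0 hX hreach b n) (Reaches.isClosed_pt hX.isClosed (reaches_chain hreach hc (b + n)))
    (exists_isOpen_inter_nearLocus_eq_singleton_of_iso hc hRa hν h0 hX hreach b n hiso)

end Moving.Seg

end Summit.ResolutionOfSingularities.ResolutionOfSingularities.Theorems.SigmaMaxModificationsCorridor3

end
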